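import Literature.AlgebraicGeometry.Frobenioids.ArithmeticFrobenioidStandard
import Literature.AlgebraicGeometry.Frobenioids.ArithmeticFrobenioidIsotropic
import Literature.AlgebraicGeometry.Frobenioids.ArithmeticFrobenioidRealificationDivSlim
import Literature.AlgebraicGeometry.Frobenioids.ArithmeticFrobenioidRealificationHypotheses
import Literature.AlgebraicGeometry.Frobenioids.Prop55SubStandardHolds
import Literature.AlgebraicGeometry.Frobenioids.UnitTrivializationModelType
import Literature.AlgebraicGeometry.Frobenioids.Prop55iiiRlfModel
import Literature.AlgebraicGeometry.Frobenioids.PerfectionFrobeniusCompactHolds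
import Literature.AlgebraicGeometry.Frobenioids.PerfectionModelType
import Literature.AlgebraicGeometry.Frobenioids.PerfectionIsFrobenioid
import Literature.AlgebraicGeometry.Frobenioids.PerfectionIsotropic
import Literature.AlgebraicGeometry.Frobenioids.PerfectionUnitsIsoGeneral
import Literature.AlgebraicGeometry.Frobenioids.UnitTrivializationStandardTypeProofs
import Literature.AlgebraicGeometry.Frobenioids.ModelFrobenioidTypeBridge
import Literature.AlgebraicGeometry.Frobenioids.ModelFrobenioidNormalized
import Literature.AlgebraicGeometry.Frobenioids.ModelFrobenioidModelType
import Literature.AlgebraicGeometry.Frobenioids.Thm42SubAssemblyIGeneral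
import HarnessLib

/-!
# Frobenioids I, Theorem 6.4 (i): the variants `C^pf`, `C^rlf`, `C^un-tr`, `(C^pf)^un-tr` of the arithmetic
# Frobenioid `C = C_{K/F}` — Prop. 5.5 (iii) INSTANTIATED (sub-DAG row T64i/L11)

Mochizuki, *The geometry of Frobenioids I: the general theory*, Kyushu J. Math. **62** (2008) 293–400,
§6, Theorem 6.4 (i), kurims text p. 114 l. 26–27: "Then the Frobenioids `C`, `C^pf`, `C^rlf`, `C^un-tr`,
`(C^pf)^un-tr` are of isotropic and rationally standard type, but not of group-like type", proof p. 115
l. 39–40: "Thus, we conclude that `C` [hence also `C^pf`, `C^rlf`, `C^un-tr`, `(C^pf)^un-tr` — cf. Proposition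
5.5, (iii)] is of rationally standard type" [cite: MochizukiFrdI2008, Thm. 6.4 (i) p.114]; Prop. 5.5 (iii)
p. 104 ll. 36–39.

PROOF-ONLY (cell abc-iut, sub-DAG `plan/L1/SUBDAG-FrdI-Thm64.md` row **T64i/L11**, L1-lead R105 (1)/R105a (1);
seat abc-iut-w4-d086; 0 `def`, no instance, no notation — the v1 interface `Thm64i_L11_variants` is NOT
typed).  Everything is stated at THE constructed arithmetic Frobenioid of Example 6.3 / Theorem 6.4,
`C_{K/F} = arithFrobenioid F K` with structure functor
`ModelFrobenioid.toElem (arithDivisorFunctor F K) (unitsFunctor F K) (divNatTrans F K)` (abc-iut-L6-t10,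
`ArithmeticFrobenioidModel.lean`; a Frobenioid: `arithFrobenioid_isFrobenioid`), for `K/F` a finite Galois
extension of number fields, and obtained by INSTANTIATING the Prop. 5.5 slots of `Prop55Sub.lean`
(abc-iut-w4-d074) through their landed closers:

* inputs at `C` (all PROVED in the tree): standard type (`isOfStandardType_arith`, abc-iut-L6-t10), isotropic
  type (`isOfIsotropicType_arith`), not of group-like type (`not_isOfGroupLikeType_arith`), hence
  Frobenius-isotropic / Frobenius-normalized type (`arith_isOfType_isFrobeniusIsotropic`,
  `arith_isOfType_isFrobeniusNormalized`; Thm. 5.2 (ii)/(iii) for model Frobenioids), `Φ` perf-factorial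
  (`arith_isPerfFactorialOn`);
* `C^un-tr`: isotropic type (abc-iut-L1-d5 `isOfIsotropicType_untr`), standard type and not group-like
  (`Prop55iii_untr_rlf_standard` closer, abc-iut-w4-d084 p415382; `isOfGroupLikeType_of_untrData`), model type
  (abc-iut-w4-d108 `isOfModelType_untr'` / `isOfBiratFrobeniusNormalizedType_biratData_untr`, = the slot
  `Prop55iii_untr_model`: `arith_untr_prop55iii_model`) — `arith_untr_*`;
* `C^rlf`: standard type (same closer), not group-like (`not_isZeroMonoid_rlfFunctor_of_not_groupLike` +
  Thm. 5.2 `data_isOfGroupLikeType_iff`), model type (`prop55iii_rlf_model_holds`, abc-iut-L1-d2 lineage; its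
  birational conjunct GIVEN that `C^rlf → F_{Φ^rlf}` is a Frobenioid — hypothesis `hR`, exactly as the slot;
  v2: `hR` DISCHARGED by abc-iut-L6-t10's `arithFrobenioid_rlf_isFrobenioid'` — `arith_rlf_isFrobenioid`,
  `arith_rlf_isOfModelType'`, and the four-variant conjunction `arith_variants_isotropic_standard_not_groupLike`)
  — `arith_rlf_*`;
* `C^pf`: a Frobenioid (Prop. 3.2 (iii), abc-iut-L1-d9 `Perfection.isFrobenioid`), isotropic type
  (`Perfection.isOfIsotropicType_perfection`), not group-like (`Perfection.isOfGroupLikeType_ops_iff`),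
  standard type (`prop55iii_pf_standard_of_prop55i` with Prop. 5.5 (i) discharged by abc-iut-L1-d1's
  `Perfection.prop55i_of_isIsotropic`), model type (`prop55iii_pf_model_of_isOfIsotropicType`; v3: its input
  "`C` of model type" discharged by Thm. 5.2 (ii), `arith_isOfModelType`, so `arith_pf_isOfModelType` and the
  four-variant `arith_variants_isOfModelType` are unconditional) — `arith_pf_*`;
* `(C^pf)^un-tr`: the `C^un-tr` closers applied to the Frobenioid `C^pf` — `arith_pfUntr_*`;
* the "rationally standard" conjuncts of the four variants are NOT re-derived: they are the pending slots
  `Prop55iii_pf_ratStd` / `Prop55iii_untr_rlf_ratStd` of `Prop55Sub.lean` (support predicates `Supp`;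
  holders L1-t2 g3 / w5-d250 (K), w4-d108 pf-ratStd) and enter `arith_variants_ratStd_of` BY NAME as binders.

Nothing here bears on [IUTchIII] Cor. 3.12 or asserts anything about abc.
-/

noncomputable section

namespace Literature.AlgebraicGeometry.Frobenioids

open CategoryTheory Opposite
open PreFrobenioid
open PreFrobenioidData (ofFunctor)

section Arith

variable (F : Type) [Field F] [NumberField F] (K : Type) [Field K] [Algebra F K] [IsGalois F K]

/-! ### The standing Prop. 5.5 hypotheses at `C_{K/F}` -/

omit [IsGalois F K] in
/-- `Φ : Spec L ↦ Φ(L)` is perf-factorial on `D` (Ex. 6.3 p. 113 "`Φ(L)` … perf-factorial"; objectwise form of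
abc-iut-L6-t10's `arithDivisorFunctor_isPerfFactorial`). [cite: MochizukiFrdI2008, Ex. 6.3 p.113] -/
theorem arith_isPerfFactorialOn : IsPerfFactorialOn (arithDivisorFunctor F K) :=
  fun X => arithDivisorFunctor_isPerfFactorial F K (op X)

omit [IsGalois F K] in
/-- `C_{K/F}` is of Frobenius-normalized type (every model Frobenioid is: Thm. 5.2 (iii), abc-iut-L1-t2's
`ModelFrobenioid.isOfType_isFrobeniusNormalized`). [cite: MochizukiFrdI2008, Thm. 5.2 (iii) p.101] -/
theorem arith_isOfType_isFrobeniusNormalized :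
    IsOfType (IsFrobeniusNormalized
      (ModelFrobenioid.toElem (arithDivisorFunctor F K) (unitsFunctor F K) (divNatTrans F K))) :=
  ModelFrobenioid.isOfType_isFrobeniusNormalized

omit [IsGalois F K] in
/-- `C_{K/F}` is of isotropic type, in the `PreFrobenioid` language of the Prop. 5.5 slots (from
`isOfIsotropicType_arith`, Thm. 6.4 (i) "isotropic"). [cite: MochizukiFrdI2008, Thm. 6.4 (i) p.114] -/
theorem arith_isOfIsotropicType :
    PreFrobenioid.IsOfIsotropicType
      (ModelFrobenioid.toElem (arithDivisorFunctor F K) (unitsFunctor F K) (divNatTrans F K)) :=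
  fun A => (PreFrobenioidData.ofFunctor_isIsotropic _ A).mp ((isOfIsotropicType_arith F K).obj A)

/-- `C_{K/F}` is of Frobenius-isotropic type (identities are of Frobenius type to isotropic objects).
[cite: MochizukiFrdI2008, Thm. 6.4 (i) p.114] -/
theorem arith_isOfType_isFrobeniusIsotropic :
    IsOfType (IsFrobeniusIsotropic
      (ModelFrobenioid.toElem (arithDivisorFunctor F K) (unitsFunctor F K) (divNatTrans F K))) :=
  FrdI.T42.isFrobeniusIsotropic_of_isOfIsotropicType (arithFrobenioid_isFrobenioid F K)
    (arith_isOfIsotropicType F K)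

omit [IsGalois F K] in
/-- `C_{K/F}` is NOT of group-like type, in the `ofFunctor` language of the slots (Thm. 6.4 (i); from
`not_isOfGroupLikeType_arith`: `Φ(F) ∋` the archimedean divisor `≠ 0`). [cite: MochizukiFrdI2008, Thm. 6.4 (i) p.115] -/
theorem arith_not_isOfGroupLikeType :
    ¬ (ofFunctor (arithDivisorFunctor F K)
        (ModelFrobenioid.toElem (arithDivisorFunctor F K) (unitsFunctor F K) (divNatTrans F K))).IsOfGroupLikeType :=
  not_isOfGroupLikeType_arith F K

omit [IsGalois F K] in
/-- The same in the `IsOfType (IsGroupLikeObj _)` form. [cite: MochizukiFrdI2008, Thm. 6.4 (i) p.115] -/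
theorem arith_not_isOfType_isGroupLikeObj :
    ¬ IsOfType (IsGroupLikeObj
      (ModelFrobenioid.toElem (arithDivisorFunctor F K) (unitsFunctor F K) (divNatTrans F K))) := by
  intro h
  exact arith_not_isOfGroupLikeType F K
    ⟨fun A => (PreFrobenioidData.ofFunctor_isGroupLikeObj _ A).mpr (h A)⟩

/-- `C_{K/F}` is of standard type, in the `ofFunctor` language of the slots (Thm. 6.4 (i), abc-iut-L6-t10
`isOfStandardType_arith`). [cite: MochizukiFrdI2008, Thm. 6.4 (i) p.114] -/
theorem arith_isOfStandardType :
    (ofFunctor (arithDivisorFunctor F K)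
        (ModelFrobenioid.toElem (arithDivisorFunctor F K) (unitsFunctor F K) (divNatTrans F K))).IsOfStandardType :=
  isOfStandardType_arith F K

/-! ### `C^un-tr` -/

/-- **Thm. 6.4 (i) for `C^un-tr`**: the unit-trivialization `C_{K/F}^un-tr → F_Φ` is a Frobenioid of isotropic
type (Prop. 3.3 (iv); abc-iut-L1-d5). [cite: MochizukiFrdI2008, Thm. 6.4 (i) p.115] -/
theorem arith_untr_isFrobenioid_isOfIsotropicType :
    IsFrobenioid (untrFunctor (arithFrobenioid_isFrobenioid F K)) ∧
      PreFrobenioid.IsOfIsotropicType (untrFunctor (arithFrobenioid_isFrobenioid F K)) :=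
  ⟨isFrobenioid_untr _, isOfIsotropicType_untr _⟩

/-- **Thm. 6.4 (i) for `C^un-tr` and `C^rlf`, standard type** (p. 115 l. 39–40 "hence also … — cf.
Proposition 5.5, (iii)"): both are of standard type — the slot `Prop55iii_untr_rlf_standard` at `C_{K/F}` fed with
`C_{K/F}` standard and not group-like. [cite: MochizukiFrdI2008, Thm. 6.4 (i) p.115] -/
theorem arith_untr_rlf_isOfStandardType :
    (ofFunctor (arithDivisorFunctor F K) (untrFunctor (arithFrobenioid_isFrobenioid F K))).IsOfStandardType ∧
      (ofFunctor _ (rlfToElem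
        (ModelFrobenioid.toElem (arithDivisorFunctor F K) (unitsFunctor F K) (divNatTrans F K))
        (arith_isPerfFactorialOn F K))).IsOfStandardType :=
  FrdI.Prop55Sub.prop55iii_untr_rlf_standard_holds _ (arithFrobenioid_isFrobenioid F K)
    (arith_isPerfFactorialOn F K) (arith_isOfType_isFrobeniusIsotropic F K)
    (arith_isOfType_isFrobeniusNormalized F K) (arith_not_isOfType_isGroupLikeObj F K) (arith_isOfStandardType F K)

/-- **Thm. 6.4 (i) for `C^un-tr`, not of group-like type** (a group-like `C^un-tr` would make `C` group-like:
`isOfGroupLikeType_of_untrData`). [cite: MochizukiFrdI2008, Thm. 6.4 (i) p.115] -/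
theorem arith_untr_not_isOfGroupLikeType :
    ¬ (ofFunctor (arithDivisorFunctor F K) (untrFunctor (arithFrobenioid_isFrobenioid F K))).IsOfGroupLikeType :=
  fun h => arith_not_isOfGroupLikeType F K (isOfGroupLikeType_of_untrData _ h)

/-- **Thm. 6.4 (i) for `C^un-tr`, model type** ("`C^un-tr` … [is] always of model type", Prop. 5.5 (iii)):
pre-model type and THE birationalization of `C^un-tr` of birationally Frobenius-normalized type.
[cite: MochizukiFrdI2008, Thm. 6.4 (i) p.115] -/
theorem arith_untr_isOfModelType :
    IsOfPreModelType (untrFunctor (arithFrobenioid_isFrobenioid F K)) ∧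
      PreFrobenioidData.IsOfBiratFrobeniusNormalizedType
        (biratData (isFrobenioid_untr (arithFrobenioid_isFrobenioid F K))
          (hasBiratSquares_untr (arithFrobenioid_isFrobenioid F K))) :=
  ⟨(isOfModelType_untr' (arithFrobenioid_isFrobenioid F K)).1,
    isOfBiratFrobeniusNormalizedType_biratData_untr (arithFrobenioid_isFrobenioid F K) _⟩

/-- The same as the slot `FrdI.Prop55Sub.Prop55iii_untr_model` of `Prop55Sub.lean` at `C_{K/F}` (its two
printed antecedents — Frobenius-isotropic, Frobenius-normalized type — hold at `C_{K/F}` and are not even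
needed, cf. abc-iut-w4-d108's `isOfModelType_untr'`). [cite: MochizukiFrdI2008, Thm. 6.4 (i) p.115] -/
theorem arith_untr_prop55iii_model :
    FrdI.Prop55Sub.Prop55iii_untr_model
      (ModelFrobenioid.toElem (arithDivisorFunctor F K) (unitsFunctor F K) (divNatTrans F K))
      (arithFrobenioid_isFrobenioid F K) :=
  fun _ _ => arith_untr_isOfModelType F K

/-! ### `C^rlf` -/

omit [IsGalois F K] in
/-- **Thm. 6.4 (i) for `C^rlf`, not of group-like type**: `Φ^rlf` is not the zero monoid (`Φ ↪ Φ^rlf`,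
abc-iut-L1-d2 lineage `not_isZeroMonoid_rlfFunctor_of_not_groupLike`), and a model Frobenioid is group-like
iff its divisor monoid is zero (Thm. 5.2, `ModelFrobenioid.data_isOfGroupLikeType_iff`).
[cite: MochizukiFrdI2008, Thm. 6.4 (i) p.115] -/
theorem arith_rlf_not_isOfGroupLikeType :
    ¬ (ofFunctor _ (rlfToElem
        (ModelFrobenioid.toElem (arithDivisorFunctor F K) (unitsFunctor F K) (divNatTrans F K))
        (arith_isPerfFactorialOn F K))).IsOfGroupLikeType := by
  intro h
  exact not_isZeroMonoid_rlfFunctor_of_not_groupLike _ (arith_isPerfFactorialOn F K)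
    (arith_not_isOfType_isGroupLikeObj F K) ((ModelFrobenioid.data_isOfGroupLikeType_iff _ _ _).mp h)

/-- **Thm. 6.4 (i) for `C^rlf`, model type** ("`C^rlf` [is] always of model type", Prop. 5.5 (iii)): pre-model
type, and — GIVEN that `C^rlf → F_{Φ^rlf}` is a Frobenioid (to FORM its birationalization; hypothesis `hR` as
in the slot `Prop55iii_rlf_model`) — birationally Frobenius-normalized type.
[cite: MochizukiFrdI2008, Thm. 6.4 (i) p.115] -/
theorem arith_rlf_isOfModelType :
    IsOfPreModelType (rlfToElem
        (ModelFrobenioid.toElem (arithDivisorFunctor F K) (unitsFunctor F K) (divNatTrans F K))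
        (arith_isPerfFactorialOn F K)) ∧
      ∀ hR : IsFrobenioid (rlfToElem
        (ModelFrobenioid.toElem (arithDivisorFunctor F K) (unitsFunctor F K) (divNatTrans F K))
        (arith_isPerfFactorialOn F K)),
        PreFrobenioidData.IsOfBiratFrobeniusNormalizedType (biratData hR (hasBiratSquares_of_isFrobenioid hR)) :=
  prop55iii_rlf_model_holds _ (arith_isPerfFactorialOn F K) (arithFrobenioid_isFrobenioid F K)
    (arith_isOfType_isFrobeniusIsotropic F K) (arith_isOfType_isFrobeniusNormalized F K)

/-! ### `C^pf` -/

/-- **Prop. 3.2 (iii) at `C_{K/F}`: the perfection `C^pf → F_{Φ^pf}` is a Frobenioid** (abc-iut-L1-d9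
`Perfection.isFrobenioid`, `C_{K/F}` being of Frobenius-isotropic type). [cite: MochizukiFrdI2008, Prop. 3.2 (iii) p.59] -/
theorem arith_pf_isFrobenioid :
    IsFrobenioid (Perfection.ops (arithFrobenioid_isFrobenioid F K)).toFunctor :=
  Perfection.isFrobenioid (arithFrobenioid_isFrobenioid F K) (arith_isOfType_isFrobeniusIsotropic F K)

/-- **Thm. 6.4 (i) for `C^pf`, isotropic type** (Prop. 3.2 (iii), isotropic clause).
[cite: MochizukiFrdI2008, Thm. 6.4 (i) p.115] -/
theorem arith_pf_isOfIsotropicType :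
    (Perfection.ops (arithFrobenioid_isFrobenioid F K)).IsOfIsotropicType :=
  Perfection.isOfIsotropicType_perfection _ (arith_isOfType_isFrobeniusIsotropic F K)

/-- **Thm. 6.4 (i) for `C^pf`, not of group-like type** (`Φ ↪ Φ^pf`: `Perfection.isOfGroupLikeType_ops_iff`).
[cite: MochizukiFrdI2008, Thm. 6.4 (i) p.115] -/
theorem arith_pf_not_isOfGroupLikeType :
    ¬ (Perfection.ops (arithFrobenioid_isFrobenioid F K)).IsOfGroupLikeType :=
  fun h => arith_not_isOfGroupLikeType F K ((Perfection.isOfGroupLikeType_ops_iff _).mp h)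

/-- **Prop. 5.5 (i) at `C_{K/F}`** holds at every object (abc-iut-L1-d1's `Perfection.prop55i_of_isIsotropic`,
`C_{K/F}` being of Frobenius-normalized type). [cite: MochizukiFrdI2008, Prop. 5.5 (i) p.104] -/
theorem arith_prop55i (A : arithFrobenioid F K) :
    FrdI.Prop55Sub.Prop55i
      (ModelFrobenioid.toElem (arithDivisorFunctor F K) (unitsFunctor F K) (divNatTrans F K))
      (arithFrobenioid_isFrobenioid F K) A :=
  fun _ hnorm hA => Perfection.prop55i_of_isIsotropic (arithFrobenioid_isFrobenioid F K) hnorm hA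

/-- **Thm. 6.4 (i) for `C^pf`, standard type** (p. 115 l. 39–40 "cf. Proposition 5.5, (iii)": the slot
`Prop55iii_pf_standard` with Prop. 3.2 (iii) and Prop. 5.5 (i) DISCHARGED at `C_{K/F}`).
[cite: MochizukiFrdI2008, Thm. 6.4 (i) p.115] -/
theorem arith_pf_isOfStandardType :
    (Perfection.ops (arithFrobenioid_isFrobenioid F K)).IsOfStandardType :=
  FrdI.Prop55Sub.prop55iii_pf_standard_of_prop55i (arithFrobenioid_isFrobenioid F K)
    (arith_pf_isFrobenioid F K) (arith_prop55i F K) (arith_isOfType_isFrobeniusIsotropic F K)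
    (arith_isOfType_isFrobeniusNormalized F K) (arith_isOfStandardType F K)

/-- **Thm. 6.4 (i) for `C^pf`, model type** (pre-model and, at THE birationalization of the Frobenioid `C^pf`,
birationally Frobenius-normalized), from the model type of `C_{K/F}` (Thm. 6.4 (i): "of model … type",
hypothesis `hmodel` = the typed conjuncts for `C_{K/F}`, cf. T62iii/T64i rows) via the slot
`Prop55iii_pf_model` for `C` of isotropic type (abc-iut-w5-d042 / w5-d227).
[cite: MochizukiFrdI2008, Thm. 6.4 (i) p.115] -/
theorem arith_pf_isOfModelType_of
    (hmodel : IsOfPreModelType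
        (ModelFrobenioid.toElem (arithDivisorFunctor F K) (unitsFunctor F K) (divNatTrans F K)) ∧
      PreFrobenioidData.IsOfBiratFrobeniusNormalizedType
        (biratData (arithFrobenioid_isFrobenioid F K)
          (hasBiratSquares_of_isFrobenioid (arithFrobenioid_isFrobenioid F K)))) :
    IsOfPreModelType (Perfection.ops (arithFrobenioid_isFrobenioid F K)).toFunctor ∧
      PreFrobenioidData.IsOfBiratFrobeniusNormalizedType
        (biratData (arith_pf_isFrobenioid F K) (hasBiratSquares_of_isFrobenioid (arith_pf_isFrobenioid F K))) :=
  FrdI.Prop55Sub.prop55iii_pf_model_of_isOfIsotropicType (arithFrobenioid_isFrobenioid F K)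
    (arith_isOfIsotropicType F K) (arith_isOfType_isFrobeniusIsotropic F K)
    (arith_isOfType_isFrobeniusNormalized F K) (arith_pf_isFrobenioid F K) hmodel

/-! ### `(C^pf)^un-tr` -/

/-- **Thm. 6.4 (i) for `(C^pf)^un-tr`**: a Frobenioid of isotropic type, not group-like, of standard type, of
model type — the `C^un-tr` closers applied to the Frobenioid `C^pf` of `C_{K/F}`.
[cite: MochizukiFrdI2008, Thm. 6.4 (i) p.115] -/
theorem arith_pfUntr_variants :
    IsFrobenioid (untrFunctor (arith_pf_isFrobenioid F K)) ∧
      PreFrobenioid.IsOfIsotropicType (untrFunctor (arith_pf_isFrobenioid F K)) ∧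
      ¬ (ofFunctor _ (untrFunctor (arith_pf_isFrobenioid F K))).IsOfGroupLikeType ∧
      (ofFunctor _ (untrFunctor (arith_pf_isFrobenioid F K))).IsOfStandardType ∧
      (IsOfPreModelType (untrFunctor (arith_pf_isFrobenioid F K)) ∧
        PreFrobenioidData.IsOfBiratFrobeniusNormalizedType
          (biratData (isFrobenioid_untr (arith_pf_isFrobenioid F K))
            (hasBiratSquares_untr (arith_pf_isFrobenioid F K)))) := by
  refine ⟨isFrobenioid_untr _, isOfIsotropicType_untr _,
    fun h => arith_pf_not_isOfGroupLikeType F K (isOfGroupLikeType_of_untrData _ h),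
    isOfStandardType_untr _ (arith_pf_not_isOfGroupLikeType F K) (arith_pf_isOfStandardType F K), ?_⟩
  -- model type of the unit-trivialization of ANY Frobenioid (Thm. 5.1 (iv) at `(C^pf)^un-tr`, abc-iut-w4-d108)
  exact ⟨(isOfModelType_untr' (arith_pf_isFrobenioid F K)).1,
    isOfBiratFrobeniusNormalizedType_biratData_untr (arith_pf_isFrobenioid F K) _⟩


/-! ### `C^rlf`, v2: the binder `hR` DISCHARGED (Thm. 5.2 (ii) at the realified arithmetic data) -/

/-- **`C_{K/F}^rlf → F_{Φ^rlf}` IS a Frobenioid** (Prop. 5.3 / Thm. 5.2 (ii) at the realified data of Ex. 6.3;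
abc-iut-L6-t10's `arithFrobenioid_rlf_isFrobenioid'`, every perf-factoriality witness — here ours).
[cite: MochizukiFrdI2008, Thm. 6.4 (i) p.114] -/
theorem arith_rlf_isFrobenioid :
    IsFrobenioid (rlfToElem
      (ModelFrobenioid.toElem (arithDivisorFunctor F K) (unitsFunctor F K) (divNatTrans F K))
      (arith_isPerfFactorialOn F K)) :=
  arithFrobenioid_rlf_isFrobenioid' F K (arith_isPerfFactorialOn F K)

/-- **Thm. 6.4 (i) for `C^rlf`, isotropic type** (abc-iut-L6-t10's `arithFrobenioid_rlf_isOfIsotropicType`).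
[cite: MochizukiFrdI2008, Thm. 6.4 (i) p.114] -/
theorem arith_rlf_isOfIsotropicType :
    PreFrobenioid.IsOfIsotropicType (rlfToElem
      (ModelFrobenioid.toElem (arithDivisorFunctor F K) (unitsFunctor F K) (divNatTrans F K))
      (arith_isPerfFactorialOn F K)) :=
  arithFrobenioid_rlf_isOfIsotropicType F K (arith_isPerfFactorialOn F K)

/-- **Thm. 6.4 (i) for `C^rlf`, model type — UNCONDITIONAL**: pre-model type and THE birationalization of
the Frobenioid `C_{K/F}^rlf` of birationally Frobenius-normalized type (the binder `hR` of
`arith_rlf_isOfModelType` discharged by `arith_rlf_isFrobenioid`). [cite: MochizukiFrdI2008, Thm. 6.4 (i) p.114] -/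
theorem arith_rlf_isOfModelType' :
    IsOfPreModelType (rlfToElem
        (ModelFrobenioid.toElem (arithDivisorFunctor F K) (unitsFunctor F K) (divNatTrans F K))
        (arith_isPerfFactorialOn F K)) ∧
      PreFrobenioidData.IsOfBiratFrobeniusNormalizedType
        (biratData (arith_rlf_isFrobenioid F K) (hasBiratSquares_of_isFrobenioid (arith_rlf_isFrobenioid F K))) :=
  ⟨(arith_rlf_isOfModelType F K).1, (arith_rlf_isOfModelType F K).2 (arith_rlf_isFrobenioid F K)⟩

/-- **Thm. 6.4 (i), the four variants at `C_{K/F}` in one conjunction (all but "rationally standard")**: each of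
`C^un-tr`, `C^rlf`, `C^pf`, `(C^pf)^un-tr` is a Frobenioid of isotropic type, not of group-like type, of standard
type (p. 114 l. 26–27 with Prop. 5.5 (iii); "rationally standard" = the pending Prop55Sub ratStd slots, by name).
[cite: MochizukiFrdI2008, Thm. 6.4 (i) p.114] -/
theorem arith_variants_isotropic_standard_not_groupLike :
    (IsFrobenioid (untrFunctor (arithFrobenioid_isFrobenioid F K)) ∧
      PreFrobenioid.IsOfIsotropicType (untrFunctor (arithFrobenioid_isFrobenioid F K)) ∧
      ¬ (ofFunctor (arithDivisorFunctor F K) (untrFunctor (arithFrobenioid_isFrobenioid F K))).IsOfGroupLikeType ∧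
      (ofFunctor (arithDivisorFunctor F K) (untrFunctor (arithFrobenioid_isFrobenioid F K))).IsOfStandardType) ∧
    (IsFrobenioid (rlfToElem
        (ModelFrobenioid.toElem (arithDivisorFunctor F K) (unitsFunctor F K) (divNatTrans F K))
        (arith_isPerfFactorialOn F K)) ∧
      PreFrobenioid.IsOfIsotropicType (rlfToElem
        (ModelFrobenioid.toElem (arithDivisorFunctor F K) (unitsFunctor F K) (divNatTrans F K))
        (arith_isPerfFactorialOn F K)) ∧
      ¬ (ofFunctor _ (rlfToElem
        (ModelFrobenioid.toElem (arithDivisorFunctor F K) (unitsFunctor F K) (divNatTrans F K))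
        (arith_isPerfFactorialOn F K))).IsOfGroupLikeType ∧
      (ofFunctor _ (rlfToElem
        (ModelFrobenioid.toElem (arithDivisorFunctor F K) (unitsFunctor F K) (divNatTrans F K))
        (arith_isPerfFactorialOn F K))).IsOfStandardType) ∧
    (IsFrobenioid (Perfection.ops (arithFrobenioid_isFrobenioid F K)).toFunctor ∧
      (Perfection.ops (arithFrobenioid_isFrobenioid F K)).IsOfIsotropicType ∧
      ¬ (Perfection.ops (arithFrobenioid_isFrobenioid F K)).IsOfGroupLikeType ∧
      (Perfection.ops (arithFrobenioid_isFrobenioid F K)).IsOfStandardType) ∧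
    (IsFrobenioid (untrFunctor (arith_pf_isFrobenioid F K)) ∧
      PreFrobenioid.IsOfIsotropicType (untrFunctor (arith_pf_isFrobenioid F K)) ∧
      ¬ (ofFunctor _ (untrFunctor (arith_pf_isFrobenioid F K))).IsOfGroupLikeType ∧
      (ofFunctor _ (untrFunctor (arith_pf_isFrobenioid F K))).IsOfStandardType) :=
  ⟨⟨(arith_untr_isFrobenioid_isOfIsotropicType F K).1, (arith_untr_isFrobenioid_isOfIsotropicType F K).2,
      arith_untr_not_isOfGroupLikeType F K, (arith_untr_rlf_isOfStandardType F K).1⟩,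
    ⟨arith_rlf_isFrobenioid F K, arith_rlf_isOfIsotropicType F K, arith_rlf_not_isOfGroupLikeType F K,
      (arith_untr_rlf_isOfStandardType F K).2⟩,
    ⟨arith_pf_isFrobenioid F K, arith_pf_isOfIsotropicType F K, arith_pf_not_isOfGroupLikeType F K,
      arith_pf_isOfStandardType F K⟩,
    ⟨(arith_pfUntr_variants F K).1, (arith_pfUntr_variants F K).2.1, (arith_pfUntr_variants F K).2.2.1,
      (arith_pfUntr_variants F K).2.2.2.1⟩⟩


/-! ### v3: `C_{K/F}` is of model type (Thm. 5.2 (ii)), hence `C^pf` is of model type — `hmodel` DISCHARGED -/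

/-- **`C_{K/F}` is of model type** — pre-model type and THE birationalization of birationally
Frobenius-normalized type ([FrdI] Thm. 5.2 (ii) "`C` is a Frobenioid of … model … type" for the model
Frobenioid of `(Φ, B)` with `Φ` divisorial and `B` group-like; abc-iut-w4-d103 `ModelFrobenioid.isOfModelType` /
abc-iut-L1-d10 `isOfBiratFrobeniusNormalizedType_of_isDivisorial`, at Ex. 6.3's `arithDivisorFunctor_isDivisorial`
and `unitsFunctor_isGroupLike`). [cite: MochizukiFrdI2008, Thm. 5.2 (ii) p.101] -/
theorem arith_isOfModelType :
    IsOfPreModelType (ModelFrobenioid.toElem (arithDivisorFunctor F K) (unitsFunctor F K) (divNatTrans F K)) ∧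
      PreFrobenioidData.IsOfBiratFrobeniusNormalizedType
        (biratData (arithFrobenioid_isFrobenioid F K)
          (hasBiratSquares_of_isFrobenioid (arithFrobenioid_isFrobenioid F K))) :=
  ⟨(ModelFrobenioid.isOfModelType (arithFrobenioid_isFrobenioid F K) (arithDivisorFunctor_isDivisorial F K)
      (unitsFunctor_isGroupLike F K)).1,
    ModelFrobenioid.isOfBiratFrobeniusNormalizedType_of_isDivisorial (arithFrobenioid_isFrobenioid F K) _
      (arithDivisorFunctor_isDivisorial F K) (unitsFunctor_isGroupLike F K)⟩

/-- **Thm. 6.4 (i) for `C^pf`, model type — UNCONDITIONAL** (the binder `hmodel` of `arith_pf_isOfModelType_of`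
discharged by `arith_isOfModelType`): `C_{K/F}^pf → F_{Φ^pf}` is of pre-model type and THE birationalization of
the Frobenioid `C_{K/F}^pf` is of birationally Frobenius-normalized type. [cite: MochizukiFrdI2008, Thm. 6.4 (i) p.114] -/
theorem arith_pf_isOfModelType :
    IsOfPreModelType (Perfection.ops (arithFrobenioid_isFrobenioid F K)).toFunctor ∧
      PreFrobenioidData.IsOfBiratFrobeniusNormalizedType
        (biratData (arith_pf_isFrobenioid F K) (hasBiratSquares_of_isFrobenioid (arith_pf_isFrobenioid F K))) :=
  arith_pf_isOfModelType_of F K (arith_isOfModelType F K)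

/-- **Thm. 6.4 (i), model type of all four variants at `C_{K/F}`, unconditionally** (Prop. 5.5 (iii): "`C^un-tr`,
`C^rlf` are always of model type", "if `C` is of … model type, then so is `C^pf`", and `(C^pf)^un-tr` as the
unit-trivialization of the Frobenioid `C^pf`): pre-model type ∧ birationally Frobenius-normalized type of THE
birationalization, for each variant. [cite: MochizukiFrdI2008, Thm. 6.4 (i) p.114] -/
theorem arith_variants_isOfModelType :
    (IsOfPreModelType (untrFunctor (arithFrobenioid_isFrobenioid F K)) ∧
      PreFrobenioidData.IsOfBiratFrobeniusNormalizedType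
        (biratData (isFrobenioid_untr (arithFrobenioid_isFrobenioid F K))
          (hasBiratSquares_untr (arithFrobenioid_isFrobenioid F K)))) ∧
    (IsOfPreModelType (rlfToElem
        (ModelFrobenioid.toElem (arithDivisorFunctor F K) (unitsFunctor F K) (divNatTrans F K))
        (arith_isPerfFactorialOn F K)) ∧
      PreFrobenioidData.IsOfBiratFrobeniusNormalizedType
        (biratData (arith_rlf_isFrobenioid F K) (hasBiratSquares_of_isFrobenioid (arith_rlf_isFrobenioid F K)))) ∧
    (IsOfPreModelType (Perfection.ops (arithFrobenioid_isFrobenioid F K)).toFunctor ∧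
      PreFrobenioidData.IsOfBiratFrobeniusNormalizedType
        (biratData (arith_pf_isFrobenioid F K) (hasBiratSquares_of_isFrobenioid (arith_pf_isFrobenioid F K)))) ∧
    (IsOfPreModelType (untrFunctor (arith_pf_isFrobenioid F K)) ∧
      PreFrobenioidData.IsOfBiratFrobeniusNormalizedType
        (biratData (isFrobenioid_untr (arith_pf_isFrobenioid F K))
          (hasBiratSquares_untr (arith_pf_isFrobenioid F K)))) :=
  ⟨arith_untr_isOfModelType F K, arith_rlf_isOfModelType' F K, arith_pf_isOfModelType F K,
    (arith_pfUntr_variants F K).2.2.2.2⟩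

end Arith

end Literature.AlgebraicGeometry.Frobenioids

end
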